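import Literature.Geometry.Lorentzian.KerrData
import Literature.Geometry.Lorentzian.KerrWaveDecay
import Literature.Geometry.Lorentzian.ChartCalculus
import HarnessLib

/-!
# Barrier catalogue `FinalStateConjecture`: the Aretakis instability of extremal horizons
(`Literature/Barriers/FinalStateConjecture/`, D-0021; family `gr`, summit `FinalStateConjecture`;
namespace `Literature.Barriers.FinalStateConjecture` for the barrier, `Literature.Lorentz.Kerr` for two chart notions)

The final state decomposition of the summit (`Literature.Geometry.Lorentzian.FinalStateDecomposition`,
`KerrConvergence.lean`) allows extremal final holes, `|aᵢ| ≤ Mᵢ` (`abs_spin_le_mass`), and asks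
for `Cᵏ` convergence of the metric to Kerr on near-zone slabs `{t*ᵢ = τ, rᵢ ≤ R} ∩ {rᵢ > r₊}`,
i.e. uniformly up to the event horizon. This file vendors, as a **named fact** (D-0014), the
theorem of Aretakis that already for the linear scalar wave equation on *extremal* Kerr
(`a = M`) transversal derivatives generically do **not** decay along the future event horizon
and second transversal derivatives blow up — the "horizon instability of extremal black holes"
— which the sources record also for the linearised Einstein equations around extremal Kerr
(Lucietti–Reall) and organise into the conjectural picture "codimension-1 stability with
horizon hair" (Dafermos, GRG 57 (2025), Conj. 6.1).

* `Kerr.transversalDeriv a r₀ f` — the derivative `Y f = df(ℓ♯)` of `f : Kerr.region a r₀ → ℝ`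
  along the ingoing principal null vector `ℓ♯ = Kerr.nullVector a x` of the Kerr–Schild form; in
  ingoing Eddington–Finkelstein coordinates `(v, r, θ, φ*)` (Kerr–Schild Cartesian:
  `x + iy = (r + ia) sin θ e^{iφ*}`, `z = r cos θ`, `t* = v − r`) this is exactly Aretakis's
  transversal field `Y = ∂_r` (`∂_r = (−1, (rx + ay)/(r² + a²), (ry − ax)/(r² + a²), z/r) = ℓ♯`).
* `Kerr.horizonSection M a r₀ τ` — the sphere `S_τ = 𝓗⁺ ∩ {t* = τ}` of the future event
  horizon `{r = r₊}` (`Kerr.futureEventHorizon`) inside the horizon-penetrating chart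
  `Kerr.region a r₀`, `r₀ < r₊`; on `𝓗⁺`, `t* = v − r₊`, so these are Aretakis's sections
  `S_τ = φ_τ(Σ₀ ∩ 𝓗⁺)`.
* `AretakisInstability` — **the barrier declaration** (structured block in its docstring):
  Aretakis, ATMP 19 (2015), Thm. 3 (non-decay and `k = 2` pointwise blow-up), in existence form.

## Rendering (design)

* *Extremal Kerr on the prelude chart.* `a = M > 0`, so `r₊ = r₋ = M` (`Kerr.rPlus M M = M`);
  the chart `Kerr.region M r₀ = {r > r₀}` with `0 < r₀ < M` contains `𝓗⁺ = {r = M}`; the metric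
  is `Kerr.smoothMetric M M r₀` with wave operator `PseudoRiemannianMetric.dalembertian` under
  the instance hypotheses `[Kerr.Facts] [Kerr.SliceFacts]` (`Kerr.hasLeviCivita_smoothMetric`),
  exactly as in `BlackHoles.lean` (gr.S24) but on the horizon-penetrating chart.
* *Existence form and genericity.* Thm. 3 holds "for all solutions to the wave equation on
  extremal Kerr", with right-hand sides `c |H₀[ψ]|`, `H₀[ψ]` "a constant which depends only on
  the initial data and is generically non-zero" (an integral over `Σ₀ ∩ 𝓗⁺` from the conserved
  hierarchy `H_l^{Kerr}`, Prop. 5.1, whose coefficients are not printed explicitly). The fact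
  therefore asserts the *existence* of a solution **with localised data** exhibiting non-decay
  and blow-up, which is weaker than the printed theorem: Thm. 3 holds for every solution with
  `H₀[ψ] ≠ 0`, and `H₀` is generically non-zero already among smooth data supported near
  `S₀ = Σ₀ ∩ 𝓗⁺`. Localisation (review of the first submission): `ψ` vanishes on an open set of
  the chart containing the far part `{t* = 0} ∩ {r ≥ R}` of the initial leaf, for some `R` — for
  data supported in `{r < R − 1}` this holds by the domain of dependence property — so the
  witness is a solution arising from compactly supported data, the class every stability
  statement (and the summit's `FinalStateDecomposition`) is about. Regularity: `ψ` is `C^∞`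
  and solves `□_g ψ = 0` on some open `U ⊇ {r ≥ M} ∩ {t* ≥ 0}` of the chart — satisfied by
  Aretakis's solutions, which arise from smooth data on the spacelike leaf
  `Σ₀ = {t* = 0} ∩ {r > r₀}` crossing `𝓗⁺` and are smooth on its Cauchy development, an open set
  containing `{r ≥ M, t* ≥ 0}` (past-directed causal curves from `{r ≥ M}` stay in `{r ≥ M}` and
  `t*` is a time function on the chart, `Kerr.timeOrientation`).
* *Norms.* Non-decay: `∃ c > 0, ∀ τ ≥ 0, ∃ x ∈ S_τ, c ≤ |Yψ(x)|` (the printed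
  `sup_{S_τ} |Yψ| ≥ c|H₀[ψ]|`, the supremum over the compact sphere being attained); blow-up for
  `k = 2`: `∃ c > 0, ∃ τ₁, ∀ τ ≥ τ₁, ∃ x ∈ S_τ, c τ ≤ |Y Y ψ(x)|` ("asymptotically along `𝓗⁺`").
  The energy blow-up clause and `k ≥ 3` are not vendored.

## Barrier audit (2026-08-15): the narrowed block `AretakisInstabilityNarrow`

A refuter audit (D-0021) found the vendored fact faithful to Thm. 3 and its scope caveats honest,
but the BARRIER block's `technique_class`/`blocks` wording broader than what the sources
establish, in three respects. (N1) Since human ruling F4 (2026-08-15) the summit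
`FinalStateConjecture` demands `Kerr.IsSubextremal (d.mass i) (d.spin i)` of EVERY final hole (and
the `Development.SettlesToKerrFamily` form named in `blocks:` is no longer the summit's, audit g6, B1), so the fact — whose
parameters `(M, M)` are never sub-extremal, `not_isSubextremal_self` — constrains techniques that
are uniform on the closed spin range, not the summit's conclusion; for every `|a| < M` the SAME
transversal derivative decays uniformly up to `𝓗⁺` (Dafermos–Rodnianski–Shlapentokh-Rothman,
Cor. 3.1 (31): the library fact `drsr_wave_derivative_decay_kerr`). (N2) The order `k ≥ 1` at
which "`C^k` convergence to an extremal Kerr metric up to the horizon" is said to be blocked is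
that of the SCALAR model: for the metric the sources document failure of `C²` convergence only in
the Einstein–Maxwell(–scalar field) models (Angelopoulos–Kehle–Unger 2024, Thm. 2; Apetroaie 2022)
and in vacuum only from one transverse derivative of the curvature component `δΨ₄` on
(Lucietti–Reall 2012, §2.2), while `C⁰` convergence to the extremal member WITH horizon hair is a
theorem in the spherically symmetric model (Angelopoulos–Kehle–Unger 2024, Thm. 1). (N3) The tags
`kerr-stability, extremal-limit, near-extremal, closed-spin-range` are not closed off as classes
(weak stability, `C⁰` codimension-1 stability at extremality, transient-then-decaying growth on
near-extremal holes). This file therefore appends (append protocol; the original block is kept,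
its scope caveats (f)–(h) pointing here):

* `Kerr.sum_sq_nullVector`, `Kerr.transversalDeriv_sq_le_two_mul_coordEnergyDensity` — the
  elementary comparison `(Yψ)² ≤ 2 ∑_μ (∂_μψ̃)²` (`∑_μ (ℓ♯_μ)² = 2` by the nullity of `ℓ`,
  Cauchy–Schwarz), linking Aretakis's `Y` to the coordinate energy density of `WeightedNorms.lean`
  (imports `KerrWaveDecay`, `ChartCalculus`);
* `not_isSubextremal_self` — `¬ Kerr.IsSubextremal M M`;
* `transversalDeriv_sq_le_of_derivative_decay` — conjunct (2) below, PROVED from the library fact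
  `drsr_wave_derivative_decay_kerr` (DRSR (31)) and the comparison lemma, constant `2C`;
* `AretakisInstabilityNarrow` — the narrowed barrier: conjunct (1) = `AretakisInstability`,
  conjunct (2) = decay of `(Yψ)²` like `τ^{-4+2δ}` on the near-zone leaves `{t* = τ} ∩ {r > r₊} ∩
  {‖y‖ ≤ R}` of every SUB-extremal Kerr exterior for DRSR's admissible waves; its docstring carries
  the corrected BARRIER block. **Form (review-split, 2026-08-15):** it is the THEOREM
  `AretakisInstabilityNarrow : AretakisInstability → drsr_wave_derivative_decay_kerr → (1) ∧ (2)`,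
  i.e. its hypotheses are exactly its trust base among the catalogued named facts. As first appended
  by the audit it was the constant `def AretakisInstabilityNarrow : Prop := (1) ∧ (2)` together with
  `AretakisInstabilityNarrow.of_facts : AretakisInstability → drsr_wave_derivative_decay_kerr →
  AretakisInstabilityNarrow` and the projection `AretakisInstability.of_narrow`; as a `def … : Prop`
  without `_holds` that constant was one more entry in the debt census although it has no source and
  no content beyond the two catalogued facts it conjoins (its discharge would be, and could only be,
  theirs), so the review-split merged it back into them: same name, same block, same conclusion, the
  projection `of_narrow` (= `.1`) absorbed and `AretakisInstabilityNarrow.of_facts` kept as a synonym of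
  the theorem. No statement of `AretakisInstability` and no other declaration changed;
* `AretakisInstabilityNarrow.transversalDeriv_tendsto_zero` spells out, under
  `drsr_wave_derivative_decay_kerr`, `Yψ → 0` up to `𝓗⁺` for `|a| < M`, to be contrasted with
  `AretakisInstability.exists_nondecaying` at `a = M`.

## References

* S. Aretakis, *Horizon instability of extremal black holes*, Adv. Theor. Math. Phys. 19 (2015)
  507–530 (arXiv:1206.6598), §2.1 (A1–A4), Thms. 1–2 (p. 10), §5.2, Prop. 5.1 and Thm. 3
  (p. 12).
* S. Aretakis, *Decay of axisymmetric solutions of the wave equation on extreme Kerr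
  backgrounds*, J. Funct. Anal. 263 (2012) 2770–2831.
* J. Lucietti, H. S. Reall, *Gravitational instability of an extreme Kerr black hole*, Phys.
  Rev. D 86 (2012) 104030.
* M. Dafermos, *The stability problem for extremal black holes*, Gen. Relativity Gravitation 57
  (2025), §3.1 (Thm. 3.1), §5.1–§5.4, §6.1 (Conj. 6.1), §6.2 (Conj. 6.2), §6.4.
* M. Dafermos, I. Rodnianski, Y. Shlapentokh-Rothman, Ann. of Math. 183 (2016) (arXiv:1402.7034),
  §1 (p. 4) and §1.1.4 (p. 7).
* J. Sbierski, Anal. PDE 8 (2015) 1379–1420, §1 (item 2, p. 2), §3.1.4.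
* C. Kehle, R. Unger, *Gravitational collapse to extremal black holes and the third law of black
  hole thermodynamics*, J. Eur. Math. Soc. (2025) (arXiv:2211.15742).
* M. A. Apetroaie, *Instability of gravitational and electromagnetic perturbations of extremal
  Reissner–Nordström spacetime*, arXiv:2211.09182 (2022), §1.1 (Theorem, rough version, and
  Remarks 1.1–1.2, pp. 4–5) (key `Apetroaie2022`).
* Y. Angelopoulos, C. Kehle, R. Unger, *Nonlinear stability of extremal Reissner–Nordström black
  holes in spherical symmetry*, arXiv:2410.16234 (2024), Thms. 1–2 (rough versions, §1.1) and
  Thm. 2 (§3) (key `AngelopoulosKehleUnger2024`).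
* D. Gajic, *Azimuthal instabilities on extremal Kerr*, arXiv:2302.06636 (2023), Thms. 1.1–1.2
  (p. 3) and Remarks 1.3–1.4 (p. 4) (key `Gajic2023`).
* R. Teixeira da Costa, *Mode stability for the Teukolsky equation on extremal and subextremal Kerr
  spacetimes*, Commun. Math. Phys. 378 (2020) 705–781, arXiv:1910.02854 (key `Costa2019`).
* M. Casals, S. E. Gralla, P. Zimmerman, *Horizon instability of extremal Kerr black holes:
  nonaxisymmetric modes and enhanced growth rate*, Phys. Rev. D 94 (2016) 064003, arXiv:1606.08505
  (key `CasalsGrallaZimmerman2016`); L. M. Burko, G. Khanna, S. Sabharwal, *Scalar and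
  gravitational hair for extreme Kerr black holes*, Phys. Rev. D 103 (2021) L021502
  (key `BurkoKhannaSabharwal2021`).
-/

noncomputable section

open Set Filter Topology
open scoped Manifold ContDiff

namespace Literature.Barriers.FinalStateConjecture.Kerr

/-- The **transversal (ingoing principal null) derivative** `Y f (x) = df_x(ℓ♯)` of a real
function on the Kerr–Schild chart `Kerr.region a r₀`, along `ℓ♯ = Kerr.nullVector a x =
(−1, (rx + ay)/(r² + a²), (ry − ax)/(r² + a²), z/r)`, which is the coordinate field `∂_r` of
ingoing Eddington–Finkelstein coordinates `(v, r, θ, φ*)` — Aretakis's `Y`. Deliberate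
dot-notation extension of the prelude namespace `Literature.Lorentz.Kerr`. Aretakis, ATMP 19 (2015),
§2.2 and §5.2 (`Y = ∂_r`); Kerr–Schild 1965 (the null vector `ℓ♯`). [cite: Aretakis2015, §2.2 and §5.2] -/
def transversalDeriv (a r₀ : ℝ) (f : Literature.Geometry.Lorentzian.Kerr.region a r₀ → ℝ) : Literature.Geometry.Lorentzian.Kerr.region a r₀ → ℝ :=
  fun x ↦ mfderiv 𝓘(ℝ, Literature.Geometry.Lorentzian.E4) 𝓘(ℝ, ℝ) f x (Literature.Geometry.Lorentzian.Kerr.nullVector a (x : Literature.Geometry.Lorentzian.E4))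

/-- Unfolding lemma for `transversalDeriv`. [folklore] -/
theorem transversalDeriv_apply (a r₀ : ℝ) (f : Literature.Geometry.Lorentzian.Kerr.region a r₀ → ℝ) (x : Literature.Geometry.Lorentzian.Kerr.region a r₀) :
    transversalDeriv a r₀ f x = mfderiv 𝓘(ℝ, Literature.Geometry.Lorentzian.E4) 𝓘(ℝ, ℝ) f x (Literature.Geometry.Lorentzian.Kerr.nullVector a (x : Literature.Geometry.Lorentzian.E4)) :=
  rfl

/-- The **horizon section** `S_τ = 𝓗⁺ ∩ {t* = τ}`: the points of the chart `Kerr.region a r₀`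
on the future event horizon `{r = r₊}` (`Kerr.futureEventHorizon M a`) with Kerr–Schild time
`t* = τ` (a round `(θ, φ*)`-sphere when `r₀ < r₊`). Aretakis, ATMP 19 (2015), §2.2
(`S_τ = Σ_τ ∩ 𝓗⁺`); Dafermos–Rodnianski, arXiv:0811.0354, §5.1. Deliberate dot-notation
extension of `Literature.Lorentz.Kerr`. [cite: Aretakis2015, §2.2] -/
def horizonSection (M a r₀ τ : ℝ) : Set (Literature.Geometry.Lorentzian.Kerr.region a r₀) :=
  {x | (x : Literature.Geometry.Lorentzian.E4) ∈ Literature.Geometry.Lorentzian.Kerr.futureEventHorizon M a ∧ (x : Literature.Geometry.Lorentzian.E4) 0 = τ}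

/-- Membership in the horizon section: `r(x) = r₊` and `t*(x) = τ`. [folklore] -/
theorem mem_horizonSection {M a r₀ τ : ℝ} {x : Literature.Geometry.Lorentzian.Kerr.region a r₀} :
    x ∈ horizonSection M a r₀ τ ↔ Literature.Geometry.Lorentzian.Kerr.radius a (x : Literature.Geometry.Lorentzian.E4) = Literature.Geometry.Lorentzian.Kerr.rPlus M a ∧ (x : Literature.Geometry.Lorentzian.E4) 0 = τ :=
  Iff.rfl

/-- For extremal parameters `a = M ≥ 0` the two horizon radii coincide with `M`:
`r₊ = M + √(M² − M²) = M`. O'Neill 1995, Ch. 2, §2.3. [cite: ONeill1995, Ch. 2 §2.3] -/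
theorem rPlus_self (M : ℝ) : Literature.Geometry.Lorentzian.Kerr.rPlus M M = M := by
  simp [Literature.Geometry.Lorentzian.Kerr.rPlus]

end Literature.Barriers.FinalStateConjecture.Kerr

namespace Literature.Barriers.FinalStateConjecture

open Literature.Geometry.Lorentzian

/-- **Barrier (Aretakis instability): on extremal Kerr, `a = M`, transversal derivatives of
generic solutions of the wave equation do not decay along the future event horizon and second
transversal derivatives blow up linearly in time.** Aretakis, ATMP 19 (2015), Thm. 3 (Scalar
instability of extremal Kerr): "There exists a constant `c > 0` which depends only on `M` such
that for all solutions to the wave equation on extremal Kerr we have • Non-decay: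
`sup_{S_τ} |Yψ| ≥ c |H₀[ψ]|` along `𝓗⁺`, and `H₀[ψ]` is a constant which depends only on the
initial data and is generically non-zero. • Pointwise blow-up: `sup_{S_τ} |Y^k ψ| ≥
c |H₀[ψ]| τ^{k−1}` asymptotically along `𝓗⁺` for all `k ≥ 2`. • Energy blow-up [...]" (`Y = ∂_r`
in ingoing coordinates `(v, r, θ, φ*)`, `S_τ` the horizon spheres; the mechanism is the
conservation along `𝓗⁺` of the hierarchy `H_l^{Kerr}[ψ]`, Prop. 5.1, valid for any horizon
satisfying A1–A4 with the extremality condition `∇_V V = 0`, Thms. 1–2).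

**Vendored form** (existence form, weaker than printed; module docstring for every rendering
choice): for `M > 0` and `0 < r₀ < M` there are an open set `U` of the horizon-penetrating chart
`Kerr.region M r₀ = {r > r₀}` of extremal Kerr `g_{M,M}` containing `{r ≥ M} ∩ {t* ≥ 0}` and a
function `ψ`, `C^∞` on `U` with `□_{g_{M,M}} ψ = 0` on `U` and **localised data** (`ψ = 0` on an
open set containing `{t* = 0} ∩ {r ≥ R}` for some `R`), such that (non-decay) for some `c > 0`
and every `τ ≥ 0` some point `x` of the horizon sphere `S_τ = {r = M} ∩ {t* = τ}` has
`|Yψ(x)| ≥ c`, and (blow-up, `k = 2`) for some `c > 0` and all late `τ` some `x ∈ S_τ` has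
`|Y Y ψ(x)| ≥ c τ` (`Y = Kerr.transversalDeriv`, `S_τ = Kerr.horizonSection`).

BARRIER (D-0021; every clause is a quotation or close paraphrase of the cited locus):
* technique_class: kerr-stability, extremal-limit, near-extremal, uniform-in-spin, red-shift, horizon-decay, transversal-derivatives, Ck-convergence-up-to-horizon, closed-spin-range
* blocks: asymptotic-stability statements and techniques for Kerr extended to (or uniform up to) `|a| = M` that yield decay along `𝓗⁺` of transversal derivatives of perturbations arising from localised (compactly supported) data — false already for the linear scalar model [cite: Aretakis2015, Thm. 3] and recorded for the linearised Einstein equations around extremal Kerr [cite: LuciettiReall2012] [cite: Dafermos2025, §5.1] — in particular `C^k` (`k ≥ 1`) convergence to an EXTREMAL Kerr metric uniformly up to the event horizon, as the near-zone clause `FinalStateDecomposition.tendsto_truncDeviationCk` of `Literature.Geometry.Lorentzian.Development.SettlesToKerrFamily` demands of a final hole with `|aᵢ| = Mᵢ` (permitted by `abs_spin_le_mass`); red-shift-based estimates uniformly as `|a| → M` ("the degeneration of the celebrated red-shift effect at the horizon" [cite: DafermosRodnianskiShlapentokhrothman2014, §1 (p. 4)]; "trapping at the horizon of an extremal Reissner–Nordström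 (and Kerr) black hole necessarily leads to a loss of derivative in an LED statement" [cite: Sbierski2015, §1 item 2 (p. 2)]); for general non-axisymmetric data even boundedness of linear waves on extremal Kerr "remains very much open" [cite: Dafermos2025, §5.4].
* because: on an extremal (`∇_V V = 0`) axisymmetric Killing horizon there are conservation laws along `𝓗⁺` for transversal derivatives of solutions of `□_g ψ = 0` [cite: Aretakis2015, Thms. 1–2 (p. 10) and Prop. 5.1 (p. 12)]; "The seed of the instability is an exact conservation law along the horizon `𝓗⁺`, which turns out to have a similar origin to the Newman–Penrose constants at null infinity" [cite: Dafermos2025, §5.1]; hence `sup_{S_τ}|Yψ| ≥ c|H₀[ψ]|` and `sup_{S_τ}|Y^kψ| ≥ c|H₀[ψ]|τ^{k−1}` [cite: Aretakis2015, Thm. 3 (p. 12)]; for fixed higher azimuthal modes on extremal Kerr "worse instabilities arise" (Gajic) [cite: Dafermos2025, §5.4]; at the level of frequency analysis "one loses the `ε`" in the quantitative disjointness of superradiance and trapping in the extremal limit, "an additional (and separate) phenomenon to the degeneration of the red-shift" [cite: DafermosRodnianskiShlapentokhrothman2014, §1.1.4 (p. 7)].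
* evasions_known: the instability is "weak": it "is still compatible with good decay properties away from the horizon `𝓗⁺`, and moreover, the amplitude of `ψ` itself (and its tangential derivatives) may still decay along `𝓗⁺` itself" [cite: Dafermos2025, §5.2] — for axisymmetric `ψ` on extremal Kerr, pointwise decay of `ψ` and decay of the degenerate energy [cite: Aretakis2012] (quoted in [cite: Aretakis2015, §5.2 (p. 12)]); weak stability with growth bounds for linearised Einstein–Maxwell around extremal Reissner–Nordström (Apetroaie) [cite: Dafermos2025, §5.2]; small-data global existence for semilinear models on extremal Reissner–Nordström "despite the Aretakis instability" [cite: Dafermos2025, §5.3]; the conjectured nonlinear statement is CODIMENSION-1 stability of extremal Kerr WITH horizon hair, Conj. 6.1 (iv): "suitable quantities associated to derivatives of the metric grow without bound ('horizon hair') along `𝓗⁺`", its spherically symmetric Einstein–Maxwell–scalar field analogue has "just been announced (see the upcoming [40])" (Dafermos's ref. [40] = Angelopoulos–Kehle–Unger, arXiv:2410.16234) [cite: Dafermos2025, §6.1]; extremal horizons do form in finite time from regular data, so extremal final states cannot be excluded by a third law [cite: KehleUnger2025] [cite: Dafermos2025, Thm. 3.1 (§3.1)].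
* scope_caveats: (a) only the linear SCALAR wave equation on exactly extremal Kerr `a = M` is formalised; the linearised-gravity analogue is by report [cite: LuciettiReall2012] [cite: Dafermos2025, §5.1] and every nonlinear consequence (horizon hair, codimension-1 stability, or worse) is conjectural [cite: Dafermos2025, §6.1 and §6.4]; (b) existence form: the printed universality ("for all solutions", constant `c` depending only on `M`, `H₀[ψ]` generically non-zero) is dropped in favour of ONE witness with data localised on the initial leaf — the conserved quantities `H_l^{Kerr}` are not formalised; (c) only non-decay of `Yψ` and the `k = 2` pointwise blow-up are vendored — `k ≥ 3`, the energy blow-up clause and any decay statement away from `𝓗⁺` are not; (d) the horizon sections and `Y` are those of the ingoing Kerr–Schild chart (identifications argued in the module docstring, not proved), the chart-time normalisation `τ ≥ 0` starts at the data leaf `{t* = 0}`; (e) nothing is asserted for near-extremal `|a| < M`, where the sources record only the degeneration of red-shift constants and of the superradiance/trapping gap as `|a| → M` [cite: DafermosRodnianskiShlapentokhrothman2014, §1 (p. 4) and §1.1.4 (p. 7)]; (f) [barrier audit 2026-08-15 — the corrected block is the docstring of `AretakisInstabilityNarrow` below] the `blocks:` clause "in particular `C^k` (`k ≥ 1`)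 convergence to an EXTREMAL Kerr metric … as the near-zone clause … demands of a final hole with `|aᵢ| = Mᵢ` (permitted by `abs_spin_le_mass`)" predates human ruling F4 (2026-08-15): the summit `FinalStateConjecture` now conjoins `Kerr.IsSubextremal (d.mass i) (d.spin i)` for every final hole and the `Development.SettlesToKerrFamily` form is no longer the summit's (audit g6, B1), so this fact (parameters `(M, M)`, never sub-extremal: `not_isSubextremal_self`) constrains TECHNIQUES uniform on `|a| ≤ M`, not the summit's conclusion — for every `|a| < M` the same transversal derivative decays uniformly up to `𝓗⁺` [cite: DafermosRodnianskiShlapentokhrothman2014, Cor. 3.1 (31)] (`AretakisInstabilityNarrow`, conjunct (2)); (g) the order `k ≥ 1` is that of the SCALAR model `ψ`; for the METRIC of a spacetime converging to an extremal hole the sources document failure of `C²` convergence at `𝓗⁺` only with Maxwell/scalar-field matter [cite: AngelopoulosKehleUnger2024, Thm. 2] [cite: Apetroaie2022, Thm. (rough version) ii(b) (p. 4)] and, in vacuum around extremal Kerr, non-decay only from one transverse derivative of the curvature component `δΨ₄` on (`C³` of the metric perturbation, axisymmetric, conditional on decay of `δΨ₄`) [cite: LuciettiReall2012, §2.2], whereas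 `C⁰` convergence to the extremal member, with horizon hair, is PROVED in the spherically symmetric Einstein–Maxwell–scalar field model [cite: AngelopoulosKehleUnger2024, Thm. 1]; (h) the tags `kerr-stability, extremal-limit, near-extremal, uniform-in-spin, closed-spin-range` of `technique_class` are to be read through the narrowed class of `AretakisInstabilityNarrow`: what is closed off is decay of transversal derivatives AT `𝓗⁺` with constants uniform on `|a| ≤ M`; weak stability [cite: Dafermos2025, §5.2], `C⁰` codimension-1 stability at extremality [cite: AngelopoulosKehleUnger2024, Thm. 1] and transient growth followed by decay for near-extremal `|a| < M` [cite: Gajic2023, Rem. 1.4 (p. 4)] are not.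
* status: established — theorem for the scalar wave equation [cite: Aretakis2015, Thm. 3]; the gravitational (linearised Einstein) analogue is [cite: LuciettiReall2012] as reported in [cite: Dafermos2025, §5.1]; the nonlinear consequences are conjectural [cite: Dafermos2025, Conj. 6.1, Conj. 6.2 and §6.4]. -/
def AretakisInstability : Prop :=
  ∀ [Kerr.Facts] [Kerr.SliceFacts] (M : ℝ), 0 < M → ∀ r₀ ∈ Set.Ioo 0 M,
    ∃ (U : Set (Kerr.region M r₀)) (ψ : Kerr.region M r₀ → ℝ),
      IsOpen U ∧
      {x : Kerr.region M r₀ | Kerr.rPlus M M ≤ Kerr.radius M (x : E4) ∧ 0 ≤ (x : E4) 0} ⊆ U ∧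
      ContMDiffOn 𝓘(ℝ, E4) 𝓘(ℝ, ℝ) ∞ ψ U ∧
      (∀ x ∈ U, (Kerr.smoothMetric M M r₀).toPseudoRiemannianMetric.dalembertian ψ x = 0) ∧
      (∃ (R : ℝ) (V : Set (Kerr.region M r₀)), IsOpen V ∧
        {x : Kerr.region M r₀ | (x : E4) 0 = 0 ∧ R ≤ Kerr.radius M (x : E4)} ⊆ V ∧
        ∀ x ∈ V, ψ x = 0) ∧
      (∃ c > (0 : ℝ), ∀ τ : ℝ, 0 ≤ τ → ∃ x ∈ Kerr.horizonSection M M r₀ τ,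
        c ≤ |Kerr.transversalDeriv M r₀ ψ x|) ∧
      (∃ c > (0 : ℝ), ∃ τ₁ : ℝ, ∀ τ : ℝ, τ₁ ≤ τ → ∃ x ∈ Kerr.horizonSection M M r₀ τ,
        c * τ ≤ |Kerr.transversalDeriv M r₀ (Kerr.transversalDeriv M r₀ ψ) x|)

/-- Under the Aretakis fact, decay of transversal derivatives along the extremal horizon fails
inside the class of solutions with localised data: the witnessing `ψ` vanishes near the far part
of the initial leaf and yet some `c > 0` bounds `|Yψ|` from below at a point of every horizon
sphere `S_τ`, `τ ≥ 0` (unpacking of the localisation and non-decay clauses). Aretakis, ATMP 19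
(2015), Thm. 3. [cite: Aretakis2015, Thm. 3] -/
theorem AretakisInstability.exists_nondecaying (h : AretakisInstability) [Kerr.Facts]
    [Kerr.SliceFacts] {M : ℝ} (hM : 0 < M) {r₀ : ℝ} (hr₀ : r₀ ∈ Set.Ioo 0 M) :
    ∃ (U : Set (Kerr.region M r₀)) (ψ : Kerr.region M r₀ → ℝ), IsOpen U ∧
      ContMDiffOn 𝓘(ℝ, E4) 𝓘(ℝ, ℝ) ∞ ψ U ∧
      (∀ x ∈ U, (Kerr.smoothMetric M M r₀).toPseudoRiemannianMetric.dalembertian ψ x = 0) ∧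
      (∃ (R : ℝ) (V : Set (Kerr.region M r₀)), IsOpen V ∧
        {x : Kerr.region M r₀ | (x : E4) 0 = 0 ∧ R ≤ Kerr.radius M (x : E4)} ⊆ V ∧
        ∀ x ∈ V, ψ x = 0) ∧
      ∃ c > (0 : ℝ), ∀ τ : ℝ, 0 ≤ τ → ∃ x ∈ Kerr.horizonSection M M r₀ τ,
        c ≤ |Kerr.transversalDeriv M r₀ ψ x| := by
  obtain ⟨U, ψ, hU, -, hψ, hsol, hloc, hnd, -⟩ := h M hM r₀ hr₀
  exact ⟨U, ψ, hU, hψ, hsol, hloc, hnd⟩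

/-- The horizon spheres of the vendored statement are non-degenerate: for extremal parameters
they sit at radius `r = M`, inside the chart `{r > r₀}` since `r₀ < M` (`Kerr.rPlus_self`).
O'Neill 1995, Ch. 2, §2.3. [cite: ONeill1995, Ch. 2 §2.3] -/
theorem mem_horizonSection_extremal {M r₀ τ : ℝ} {x : Kerr.region M r₀} :
    x ∈ Kerr.horizonSection M M r₀ τ ↔ Kerr.radius M (x : E4) = M ∧ (x : E4) 0 = τ := by
  rw [Kerr.mem_horizonSection, Kerr.rPlus_self]

end Literature.Barriers.FinalStateConjecture

/-! ### Barrier audit (2026-08-15): the comparison `(Yψ)² ≤ 2 ∑_μ (∂_μψ)²` and the narrowed block -/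

namespace Literature.Barriers.FinalStateConjecture.Kerr

open Literature.Geometry.Lorentzian

/-- The Euclidean sum of squares of the components of the Kerr–Schild vector
`ℓ♯ = (−1, ℓ₁, ℓ₂, ℓ₃)` is `2` wherever `r > 0`: `ℓ₀ = 1` and `ℓ₁² + ℓ₂² + ℓ₃² = ℓ₀²` by the
nullity `ℓ(ℓ♯) = 0` (`Kerr.nullCovector_nullVector`). Kerr–Schild 1965; Visser arXiv:0706.0622,
(34)–(35). [cite: KerrSchild1965] -/
theorem sum_sq_nullVector {a : ℝ} {x : E4} (hx : 0 < Kerr.radius a x) :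
    ∑ μ : Fin 4, (Kerr.nullVector a x) μ ^ 2 = 2 := by
  have h0 := Kerr.nullCovector_nullVector hx
  simp only [Kerr.nullCovector, E4.covector_apply, Fin.sum_univ_four] at h0
  simp only [Fin.sum_univ_four]
  have hv : ∀ μ : Fin 4, (Kerr.nullVector a x) μ =
      (if μ = 0 then -Kerr.nullCovectorFun a x μ else Kerr.nullCovectorFun a x μ) := by
    intro μ; simp [Kerr.nullVector]
  have hz : Kerr.nullCovectorFun a x 0 = 1 := by simp [Kerr.nullCovectorFun]
  rw [hv 0, hv 1, hv 2, hv 3] at h0 ⊢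
  simp only [if_true, Fin.isValue, one_ne_zero, if_false, Fin.reduceEq] at h0 ⊢
  rw [hz] at h0 ⊢
  nlinarith [h0]

/-- **The transversal derivative is controlled by the coordinate energy density**: on any
Kerr–Schild chart `Kerr.region a r₀` (where `r > 0`), `(Yψ)(x)² ≤ 2 ∑_μ (∂_μ ψ̃)²(x)`
(`coordEnergyDensity` of `WeightedNorms.lean`, `ψ̃` the zero extension), for EVERY `ψ`: if `ψ` is
differentiable at `x` this is Cauchy–Schwarz in `ℝ⁴` with `∑_μ (ℓ♯_μ)² = 2`
(`sum_sq_nullVector`), `Yψ = dψ(ℓ♯) = ∑_μ ℓ♯_μ ∂_μψ̃` (`OpensChart.mfderiv_eq`); otherwise `Yψ(x)` is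
Mathlib's junk value `0`. This is the (only) link needed to read decay of the non-degenerate
coordinate energy density as decay of Aretakis's `Y = ∂_r`. Dafermos–Rodnianski, arXiv:0811.0354,
§4.1 (non-degenerate energy controls all derivatives). [folklore] -/
theorem transversalDeriv_sq_le_two_mul_coordEnergyDensity (a r₀ : ℝ)
    (ψ : Kerr.region a r₀ → ℝ) (x : Kerr.region a r₀) :
    transversalDeriv a r₀ ψ x ^ 2 ≤ 2 * coordEnergyDensity (Kerr.region a r₀) ψ (x : E4) := by
  set Ψ : E4 → ℝ := Function.extend Subtype.val ψ 0 with hΨdef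
  have hrep : ∀ y : Kerr.region a r₀, ψ y = Ψ y := fun y ↦
    (Subtype.val_injective.extend_apply _ _ y).symm
  have hced : coordEnergyDensity (Kerr.region a r₀) ψ (x : E4) =
      ∑ μ : Fin 4, (fderiv ℝ Ψ x (E4.basisVector μ)) ^ 2 := rfl
  by_cases hd : DifferentiableAt ℝ Ψ x
  · rw [transversalDeriv_apply, OpensChart.mfderiv_eq x ψ Ψ hrep hd, hced]
    set L : E4 →L[ℝ] ℝ := fderiv ℝ Ψ x
    have hL : L (Kerr.nullVector a (x : E4)) =
        ∑ μ : Fin 4, (Kerr.nullVector a (x : E4)) μ * L (E4.basisVector μ) := by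
      conv_lhs => rw [← (EuclideanSpace.basisFun (Fin 4) ℝ).sum_repr (Kerr.nullVector a (x : E4))]
      simp [map_sum, map_smul, EuclideanSpace.basisFun_apply]
    have hcs := Finset.sum_mul_sq_le_sq_mul_sq Finset.univ
      (fun μ : Fin 4 ↦ (Kerr.nullVector a (x : E4)) μ) (fun μ ↦ L (E4.basisVector μ))
    have hn := sum_sq_nullVector (a := a) (Kerr.radius_pos_of_mem_region x.2)
    show (L (Kerr.nullVector a (x : E4))) ^ 2 ≤ 2 * ∑ μ : Fin 4, (L (E4.basisVector μ)) ^ 2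
    rw [hL, ← hn]
    exact hcs
  · have hnd : ¬ MDifferentiableAt 𝓘(ℝ, E4) 𝓘(ℝ, ℝ) ψ x :=
      fun h ↦ hd ((OpensChart.mdifferentiableAt_iff x ψ Ψ hrep).1 h)
    have h0 : transversalDeriv a r₀ ψ x = (0 : ℝ) := by
      rw [transversalDeriv_apply, mfderiv_zero_of_not_mdifferentiableAt hnd]
      rfl
    have := coordEnergyDensity_nonneg (Kerr.region a r₀) ψ (x : E4)
    rw [h0]
    nlinarith [this]

end Literature.Barriers.FinalStateConjecture.Kerr

namespace Literature.Barriers.FinalStateConjecture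

open Literature.Geometry.Lorentzian

/-- The parameters `(M, a) = (M, M)` of the Aretakis fact are never sub-extremal
(`Kerr.IsSubextremal M a := |a| < M`), whereas the summit `FinalStateConjecture` (human ruling F4,
2026-08-15) demands `Kerr.IsSubextremal (d.mass i) (d.spin i)` of every final hole: the barrier does
not apply to the holes of the summit's decomposition (audit finding (N1)). O'Neill 1995, Ch. 2,
§2.3 (extreme Kerr, `a² = M²`). [cite: ONeill1995, Ch. 2 §2.3] -/
theorem not_isSubextremal_self (M : ℝ) : ¬ Kerr.IsSubextremal M M :=
  fun h ↦ lt_irrefl M (lt_of_abs_lt h)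

/-- **Conjunct (2) of the narrowed barrier, proved from DRSR's estimate (31).** For every
SUB-extremal `|a| < M`, every admissible wave `ψ` on the exterior chart `Kerr.exterior M a`
(`IsAdmissibleKerrWave`), every `δ > 0` and every coordinate radius `R` there is `C` with
`(Yψ)²(τ, y) ≤ C τ^{-4+2δ}` for all `τ ≥ 1` at every point `(τ, y)` of the near-zone leaf
`{t* = τ} ∩ {r > r₊} ∩ {‖y‖ ≤ R}` — the transversal field `Y = ℓ♯ = ∂_r` (`Kerr.transversalDeriv a r₊`)
decays uniformly UP TO the event horizon: DRSR's pointwise derivative decay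
`∑_μ (∂_μψ)² ≤ C τ^{-4+2δ}` on those leaves (`drsr_wave_derivative_decay_kerr`, the vendored form of
`sup_{Σ̃_τ ∩ {r ≤ R}} |n_Σ̃ψ| + |∇_Σ̃ψ| ≤ C(a₀, M, δ, R) E τ^{-2+δ}`) composed with
`(Yψ)² ≤ 2 ∑_μ (∂_μψ)²` (`Kerr.transversalDeriv_sq_le_two_mul_coordEnergyDensity`), constant `2C`.
Dafermos–Rodnianski–Shlapentokh-Rothman, arXiv:1402.7034, Cor. 3.1 (31) (p. 14).
[cite: DafermosRodnianskiShlapentokhrothman2014, Cor. 3.1 (31)] -/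
theorem transversalDeriv_sq_le_of_derivative_decay (h₂ : drsr_wave_derivative_decay_kerr)
    [Kerr.Facts] [Kerr.SliceFacts] {M a : ℝ} (hMa : Kerr.IsSubextremal M a)
    {ψ : Kerr.exterior M a → ℝ} (hψ : IsAdmissibleKerrWave M a ψ) {δ : ℝ} (hδ : 0 < δ) (R : ℝ) :
    ∃ C : ℝ, ∀ τ : ℝ, 1 ≤ τ → ∀ (y : E3) (hy : E4.ofTimeSpace τ y ∈ Kerr.exterior M a),
      ‖y‖ ≤ R →
        Kerr.transversalDeriv a (Kerr.rPlus M a) ψ ⟨E4.ofTimeSpace τ y, hy⟩ ^ 2 ≤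
          C * τ ^ (-4 + 2 * δ) := by
  obtain ⟨C, hC⟩ := h₂ M a hMa ψ hψ δ hδ R
  refine ⟨2 * C, fun τ hτ y hy hyR ↦ ?_⟩
  have h := hC τ hτ y hy hyR
  calc Kerr.transversalDeriv a (Kerr.rPlus M a) ψ ⟨E4.ofTimeSpace τ y, hy⟩ ^ 2
      ≤ 2 * coordEnergyDensity (Kerr.exterior M a) ψ (E4.ofTimeSpace τ y) :=
        Kerr.transversalDeriv_sq_le_two_mul_coordEnergyDensity a (Kerr.rPlus M a) ψ
          ⟨E4.ofTimeSpace τ y, hy⟩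
    _ ≤ 2 * (C * τ ^ (-4 + 2 * δ)) := by linarith
    _ = 2 * C * τ ^ (-4 + 2 * δ) := by ring

/-- **NARROWED BARRIER `AretakisInstabilityNarrow` (barrier audit of `AretakisInstability`, 2026-08-15; a THEOREM since the review-split of 2026-08-15).** Two conjuncts, both consequences of facts already vendored in this library, which are exactly the hypotheses of this theorem (`AretakisInstabilityNarrow : AretakisInstability → drsr_wave_derivative_decay_kerr → (1) ∧ (2)`; no named fact of its own, D-0026 — as the constant `def AretakisInstabilityNarrow : Prop := (1) ∧ (2)` first appended by the audit it was one more undischarged entry of the debt census with no source and no content beyond the two catalogued facts it conjoins, and the review-split merged it back into them: name, BARRIER block and conclusion unchanged, `AretakisInstabilityNarrow.of_facts` kept as a synonym of this theorem and the former projection `AretakisInstability.of_narrow` being `.1`): (1) = `AretakisInstability` — on EXTREMAL Kerr `a = M` a smooth solution of `□_g ψ = 0` with localised data has `sup_{S_τ}|Yψ| ≥ c > 0` on every horizon sphere `S_τ`, `τ ≥ 0`, and `sup_{S_τ}|YYψ| ≥ cτ` for late `τ` [cite: Aretakis2015, Thm. 3 (p. 12)]; (2) its SHARP COMPLEMENT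 in the spin parameter — for every SUB-extremal `|a| < M`, every admissible wave `ψ` (`IsAdmissibleKerrWave`: smooth solution of `□_{g_{M,a}} ψ = 0` on the exterior chart `Kerr.exterior M a = {r > r₊}` with compactly supported data on the leaf `{t* = 0}`), every `δ > 0` and every coordinate radius `R` there is `C` with `(Yψ)²(τ, y) ≤ C τ^{-4+2δ}` for all `τ ≥ 1` at every point `(τ, y)` of the near-zone leaf `{t* = τ} ∩ {r > r₊} ∩ {‖y‖ ≤ R}` — the SAME transversal field `Y = ℓ♯ = ∂_r` (`Kerr.transversalDeriv a r₊`) decays uniformly UP TO the event horizon [cite: DafermosRodnianskiShlapentokhrothman2014, Cor. 3.1 (31)] (through `(Yψ)² ≤ 2 ∑_μ (∂_μψ)²`, `Kerr.transversalDeriv_sq_le_two_mul_coordEnergyDensity`). Thus horizon non-decay of transversal derivatives is an ENDPOINT phenomenon at `|a| = M` (surface gravity `κ = 0`), and the sub-extremal constants `C = C(M, a, δ, R, ψ)` cannot be uniform as `|a| → M`. The audit (refuter, 2026-08-15) found the catalogued fact faithful and its caveats honest, but its `technique_class`/`blocks` wording broader than the sources support in three respects — (N1) target, (N2) derivative order,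 (N3) technique tags — recorded in the block below together with the literature read (page/theorem hits).
BARRIER (D-0021), FinalStateConjecture (narrowing of the block on `AretakisInstability`):
* technique_class: uniform-in-spin NON-DEGENERATE horizon estimates — arguments needing decay (or time-uniform bounds) of TRANSVERSAL derivatives `Y^kψ|_{𝓗⁺}`, `k ≥ 1`, of linear fields on Kerr, or of transversal derivatives of curvature, AT the event horizon with constants that do not degenerate as `|a| → M`: red-shift multiplier estimates with `κ`-independent constants, closed-range (`|a| ≤ M`) versions of the pointwise estimate (31) of Dafermos–Rodnianski–Shlapentokh-Rothman, `C^k`-compactness or continuity of near-zone sup norms up to `𝓗⁺` across `|a| → M` (`k ≥ 1` for scalars; for the metric see `blocks:` (c)). NOT covered, although inside the catalogued tags `kerr-stability, extremal-limit, near-extremal, uniform-in-spin, closed-spin-range`: (i) per-hole sub-extremal estimates with constants depending on `(M, a)` — conjunct (2) — which is all that the summit's near-zone clause `FinalStateDecomposition.tendsto_truncDeviationCk` consumes, hole by hole (N1); (ii) decay of the degenerate energy, decay away from `𝓗⁺`, and decay of `ψ` and its TANGENTIAL derivatives on `𝓗⁺` at exact extremality [cite: Aretakis2015, §5.2 items 1–2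 (p. 12)] [cite: Dafermos2025, §5.2]; (iii) orbital stability and `C⁰` asymptotic stability statements AT extremality, with horizon hair [cite: AngelopoulosKehleUnger2024, Thm. 1]; (iv) transient growth followed by decay on near-extremal `|a| < M` backgrounds [cite: Gajic2023, Rem. 1.4 (p. 4)].
* blocks: exactly: (a) any statement or estimate implying `sup_{S_τ}|Yψ| → 0` along `𝓗⁺` of EXTREMAL Kerr for smooth localised data with `H₀[ψ] ≠ 0` — conjunct (1) [cite: Aretakis2015, Thm. 3 (p. 12)]; for non-axisymmetric data the situation is worse, not better: generically "first-order transversal derivatives of `φ` grow at least like `τ^{1/2}` in time along a sequence of times `τₙ → ∞` along the event horizon and the `H¹` space-norm (the non-degenerate energy) is non-decaying" (or a global integrability property fails), while `φₘ|_{𝓗⁺} ∼ v^{-1/2}` [cite: Gajic2023, Thms. 1.1–1.2 (p. 3)]; (b) consequently every decay estimate for transversal derivatives at `𝓗⁺` with constants uniform on the CLOSED range `|a| ≤ M`, and every argument extracting a limit `|a| → M` of such estimates (conjuncts (1)+(2)); (c) for the METRIC of a dynamical spacetime converging to an EXTREMAL hole, `C^k` convergence uniformly up to `𝓗⁺` at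 the following documented orders: `k = 2` in the Einstein–Maxwell–scalar field model — "the metric does not necessarily decay to extremal Reissner–Nordström in `C²` (and may grow in `C³`)", `R_{YY}|_{𝓗⁺} → 2M⁻²(H₀[φ])²`, `|∇_Y R_{YY}|_{𝓗⁺}| ≳ (H₀[φ])² v` [cite: AngelopoulosKehleUnger2024, Thm. 1 (comments) and Thm. 2]; `k = 2` for linearised Einstein–Maxwell on extremal Reissner–Nordström — the negative-spin curvature component `α̲` and `∇̸_Y f̲`, `∇̸_Y β̲̃` "do not decay along `𝓗⁺`", `‖∇̸^k_Y α̲‖ ∼ τ^k` [cite: Apetroaie2022, Thm. (rough version) ii(b) (p. 4)]; `k = 3` (documented) in VACUUM around extremal Kerr, axisymmetric linearised perturbations — "if `δΨ₄` decays then a transverse derivative of `δΨ₄` generically does not decay along `𝓗⁺` and certain second transverse derivatives will blow up along `𝓗⁺`. If `δΨ₀` and its first 4 derivatives decay then a 5th transverse derivative generically will not decay, and a 6th transverse derivative will blow up" [cite: LuciettiReall2012, §2.2], the decay of the `ψ₄`-type field itself on `𝓗⁺` for axisymmetric perturbations of extreme Kerr being a numerical finding [cite: BurkoKhannaSabharwal2021]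 reported in [cite: Apetroaie2022, Rem. 1.1 (p. 4)]. It does NOT block: `C⁰` convergence of the metric (and of some Christoffel symbols) to an extremal member up to and including `𝓗⁺` [cite: AngelopoulosKehleUnger2024, Thm. 1 and the comments after it]; `C²` convergence to an extremal KERR hole in vacuum is undocumented either way ((N2), scope caveat (c)); and nothing about SUB-extremal final holes, the only ones the summit admits.
* because: conjunct (1): conservation along the extremal horizon of `H₀^{Kerr}[ψ](τ) = ∫_{S_τ}(M sin²θ Tψ + 4M Yψ + 2ψ)` [cite: Aretakis2015, §5.2 and Prop. 5.1 (p. 12)] combined with the decay of axisymmetric `ψ` [cite: Aretakis2012, Thm. 5], "the seed of the instability is an exact conservation law along the horizon `𝓗⁺`" [cite: Dafermos2025, §5.1]; conjunct (2): for `|a| < M` the red-shift at `𝓗⁺` is non-degenerate and the `N`-multiplier estimates give `sup_{Σ̃_τ ∩ {r ≤ R}} |n_Σ̃ψ| + |∇_Σ̃ψ| ≤ C(a₀, M, δ, R) E τ^{-2+δ}`, `|a| ≤ a₀ < M` [cite: DafermosRodnianskiShlapentokhrothman2014, Cor. 3.1 (31)], with constants tied to `a₀ < M` through "the degeneration of the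 celebrated red-shift effect at the horizon" in the extremal limit [cite: DafermosRodnianskiShlapentokhrothman2014, §1 (p. 4)]; the two regimes are separated exactly by `κ = 0 ⇔ |a| = M`; in the azimuthal case the mechanism is not a conservation law but the precise late-time tails of the modes `φₘ` [cite: Gajic2023, Rem. 1.3 (p. 4)].
* evasions_known: (i) THE SUMMIT EVADES (N1): `FinalStateConjecture` (ruling F4, 2026-08-15) requires `Kerr.IsSubextremal (d.mass i) (d.spin i)` for every final hole of the decomposition and Christodoulou-generic data, and `¬ Kerr.IsSubextremal M M` (`not_isSubextremal_self`): conjunct (1) never applies to a final hole, conjunct (2) is what the `C²` near-zone clause uses per hole; that extremal final states are NON-generic is the conjectural codimension-1 picture — "for near extremal Kerr black holes with fixed spin-to-mass ratio, one would again expect a similar codimension-1 stability statement (without of course the instability part (iv))" [cite: Dafermos2025, §6.1 (after Conj. 6.1)], the hypersurface `𝔐_stable` separating `𝔐_subextremal` from `𝔐_noncollapse` [cite: Dafermos2025, §6.2 Conj. 6.2] — PROVED in the spherically symmetric Einstein–Maxwell–scalar field model, where the data asymptoting to extremality form a teleologically defined codimension-one "submanifold" `𝔐_stab` [cite: AngelopoulosKehleUnger2024,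 Thm. 1], conjecturally a `C¹` hypersurface locally separating collapse to sub-extremal holes from dispersion [cite: AngelopoulosKehleUnger2024, §1.3.1]; (ii) (N2) asymptotic stability AT extremality is not blocked: "the metric decays polynomially in `C⁰` … to a nearby member of the extremal Reissner–Nordström family, relative to a teleologically defined double null gauge uniformly in the entire domain of outer communication", with the Aretakis instability realised as horizon hair [cite: AngelopoulosKehleUnger2024, Thms. 1–2]; (iii) (N3) weak stability: the instability "is still compatible with good decay properties away from the horizon `𝓗⁺`, and moreover, the amplitude of `ψ` itself (and its tangential derivatives, say `∂_v ψ`) may still decay along `𝓗⁺` itself" [cite: Dafermos2025, §5.2]; decay of the Teukolsky quantities away from `𝓗⁺` (`{r ≥ r₀}`, any `r₀ > M`) for linearised Einstein–Maxwell on extremal Reissner–Nordström [cite: Apetroaie2022, Thm. (rough version) i (p. 4)]; (iv) near-extremal `|a| < M`: "the azimuthal instability will instead become a 'transient instability' by Cauchy stability, i.e. quantities that blow up in extremal Kerr will instead become very large, but they will eventually decay asymptotically in time" [cite: Gajic2023, Rem. 1.4 (p. 4)] — conjunct (2) is the rigorous scalar statement of the eventual decay; (v) mode stability survives extremality [cite: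 Costa2019], "the only general statement presently known" for extremal Kerr [cite: Dafermos2025, §5.4]; (vi) the evasions of the catalogued block (semilinear models "despite the Aretakis instability", extremal horizons forming in finite time) stand [cite: Dafermos2025, §5.3 and §3.1] [cite: KehleUnger2025].
* scope_caveats: (a) conjunct (2) lives on the EXTERIOR chart `Kerr.exterior M a = {r > r₊}` for DRSR's admissible class (data compactly supported in the open exterior leaf `{t* = 0} ∩ {r > r₊}`), not on a horizon-penetrating chart: "up to the horizon" means the bound holds at every point of `{r₊ < r} ∩ {‖y‖ ≤ R}`, uniformly — exactly the shape of the near-zone sets `truncTimeSlab` of `FinalStateDecomposition.tendsto_truncDeviationCk`, whose hole charts are Poincaré images of `Kerr.exterior`; it is the SQUARE `(Yψ)²` that is bounded (no sign of `C` is asserted, as in the parent fact); the DATA CLASSES of the two conjuncts differ — the witness of (1) has data meeting the horizon sphere (`H₀[ψ] ≠ 0`), the class of (2) has data vanishing near `{r = r₊}` on the initial leaf: on EXTREMAL Kerr, data supported away from `𝓗⁺` (`H₀ = 0`) still develop the instability one transversal derivative higher (`YYψ` does not decay) [cite: Aretakis2015, §7 item 5 (p. 14)] [cite: Gajic2023,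 Rem. 1.3 (p. 4)], while for `|a| < M` higher transversal derivatives are controlled by the commuted estimates (25) [cite: DafermosRodnianskiShlapentokhrothman2014, Thm. 3.2 (25)] (integrated form; only the first-order pointwise estimate (31) is vendored, so (2) is first-order); (b) no uniformity in `a` is asserted anywhere: the audit found no printed estimate of transversal derivatives at `𝓗⁺` uniform as `|a| → M`, and conjuncts (1)+(2) show there is none for `k ≥ 1` (scalars); whether DEGENERATE (horizon-weighted) energy decay or decay away from `𝓗⁺` holds with constants uniform on `|a| ≤ M` for Kerr is not addressed by any source read — for general data on extremal Kerr even boundedness of linear waves "remains very much open" [cite: Dafermos2025, §5.4]; (c) (N2) is a reading of the linearised and model literature, not a theorem about the vacuum final-state problem: the order `k` at which `C^k` convergence to an extremal KERR hole fails in vacuum is not settled — `k ≤ 2` is undocumented, `k = 3` is conditional on the decay of `δΨ₄` [cite: LuciettiReall2012, §2.2], non-axisymmetric gravitational perturbations are understood only heuristically [cite: CasalsGrallaZimmerman2016] and "worse instabilities arise" already for scalars [cite: Dafermos2025, §5.4] [cite: Gajic2023, Thm. 1.1 (p. 3)]; in harmonic/wave-type gauges the metric components obey wave equations and inherit the scalar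 orders `k ≥ 1` — a gauge effect, the summit's charts `Ψᵢ` being free; (d) caveats (a)–(e) of the catalogued block stand unchanged; (e) if Conjectures 6.1/6.2 fail, the set of data evolving to extremal Kerr "could even be … larger, filling part of the darker shaded region, say as a fractional codimension subset" [cite: Dafermos2025, §6.4] — that scenario, not the Aretakis instability, is what would threaten the summit's "generic ⇒ sub-extremal" form, and it is not a catalogued barrier.
* status: established — conjunct (1) [cite: Aretakis2015, Thm. 3 (p. 12)] and conjunct (2) [cite: DafermosRodnianskiShlapentokhrothman2014, Cor. 3.1 (31)] are vendored named facts of this library (`AretakisInstability`, `drsr_wave_derivative_decay_kerr`) and the hypotheses of this theorem, which PROVES `(1) ∧ (2)` from them (conjunct (2) alone: `transversalDeriv_sq_le_of_derivative_decay`); the discharge of the narrowed barrier is therefore exactly the discharge of those two facts (for (1), of its leaves `KerrSchild.waveCauchyProblem` and `Aretakis2012_pointwiseDecay`, `ExtremalHorizonInstabilityLeaves.lean`). -/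
theorem AretakisInstabilityNarrow (h₁ : AretakisInstability)
    (h₂ : drsr_wave_derivative_decay_kerr) :
    AretakisInstability ∧
      ∀ [Kerr.Facts] [Kerr.SliceFacts] (M a : ℝ), Kerr.IsSubextremal M a →
        ∀ ψ : Kerr.exterior M a → ℝ, IsAdmissibleKerrWave M a ψ → ∀ δ : ℝ, 0 < δ → ∀ R : ℝ,
          ∃ C : ℝ, ∀ τ : ℝ, 1 ≤ τ → ∀ (y : E3) (hy : E4.ofTimeSpace τ y ∈ Kerr.exterior M a),
            ‖y‖ ≤ R →
              Kerr.transversalDeriv a (Kerr.rPlus M a) ψ ⟨E4.ofTimeSpace τ y, hy⟩ ^ 2 ≤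
                C * τ ^ (-4 + 2 * δ) := by
  refine ⟨h₁, ?_⟩
  intro _ _ M a hMa ψ hψ δ hδ R
  exact transversalDeriv_sq_le_of_derivative_decay h₂ hMa hψ hδ R

/-- **The narrowed barrier from the two vendored facts** — the name under which the audit first
proved the implication `AretakisInstability → drsr_wave_derivative_decay_kerr → (1) ∧ (2)`, kept as a
synonym of the theorem `AretakisInstabilityNarrow` (same hypotheses, same conclusion) for existing
references. Dafermos–Rodnianski–Shlapentokh-Rothman, arXiv:1402.7034, Cor. 3.1 (31).
[cite: DafermosRodnianskiShlapentokhrothman2014, Cor. 3.1 (31)] -/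
theorem AretakisInstabilityNarrow.of_facts (h₁ : AretakisInstability)
    (h₂ : drsr_wave_derivative_decay_kerr) :
    AretakisInstability ∧
      ∀ [Kerr.Facts] [Kerr.SliceFacts] (M a : ℝ), Kerr.IsSubextremal M a →
        ∀ ψ : Kerr.exterior M a → ℝ, IsAdmissibleKerrWave M a ψ → ∀ δ : ℝ, 0 < δ → ∀ R : ℝ,
          ∃ C : ℝ, ∀ τ : ℝ, 1 ≤ τ → ∀ (y : E3) (hy : E4.ofTimeSpace τ y ∈ Kerr.exterior M a),
            ‖y‖ ≤ R →
              Kerr.transversalDeriv a (Kerr.rPlus M a) ψ ⟨E4.ofTimeSpace τ y, hy⟩ ^ 2 ≤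
                C * τ ^ (-4 + 2 * δ) :=
  AretakisInstabilityNarrow h₁ h₂

/-- Under DRSR's derivative decay — conjunct (2) of the narrowed barrier — for every SUB-extremal
Kerr exterior the transversal derivative of an admissible wave tends to `0` along the near-zone
leaves uniformly up to the horizon: for every `R` and `ε > 0` there is `τ₁` with `|Yψ(τ, y)| ≤ ε`
whenever `τ ≥ τ₁`, `(τ, y) ∈ {r > r₊}`, `‖y‖ ≤ R` (conjunct (2) with `δ = 1`: `(Yψ)² ≤ C τ⁻²`).
Contrast with `AretakisInstability.exists_nondecaying` at `a = M`. Dafermos–Rodnianski–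
Shlapentokh-Rothman, arXiv:1402.7034, Cor. 3.1 (31) (p. 14).
[cite: DafermosRodnianskiShlapentokhrothman2014, Cor. 3.1 (31)] -/
theorem AretakisInstabilityNarrow.transversalDeriv_tendsto_zero
    (h₂ : drsr_wave_derivative_decay_kerr) [Kerr.Facts] [Kerr.SliceFacts] {M a : ℝ}
    (hMa : Kerr.IsSubextremal M a) {ψ : Kerr.exterior M a → ℝ} (hψ : IsAdmissibleKerrWave M a ψ)
    (R ε : ℝ) (hε : 0 < ε) :
    ∃ τ₁ : ℝ, ∀ τ : ℝ, τ₁ ≤ τ → ∀ (y : E3) (hy : E4.ofTimeSpace τ y ∈ Kerr.exterior M a),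
      ‖y‖ ≤ R → |Kerr.transversalDeriv a (Kerr.rPlus M a) ψ ⟨E4.ofTimeSpace τ y, hy⟩| ≤ ε := by
  obtain ⟨C, hC⟩ := transversalDeriv_sq_le_of_derivative_decay h₂ hMa hψ one_pos R
  refine ⟨max 1 (C / ε ^ 2 + 1), fun τ hτ y hy hyR ↦ ?_⟩
  have hτ1 : 1 ≤ τ := le_trans (le_max_left _ _) hτ
  have hτC : C / ε ^ 2 + 1 ≤ τ := le_trans (le_max_right _ _) hτ
  have hτpos : 0 < τ := by linarith
  have hb := hC τ hτ1 y hy hyR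
  have hexp : (-4 + 2 * (1 : ℝ)) = -2 := by norm_num
  rw [hexp, Real.rpow_neg hτpos.le, Real.rpow_two] at hb
  -- hb : Y² ≤ C * (τ ^ 2)⁻¹
  set Y := Kerr.transversalDeriv a (Kerr.rPlus M a) ψ ⟨E4.ofTimeSpace τ y, hy⟩ with hY
  have hτ2 : 0 < τ ^ 2 := by positivity
  have hYsq : Y ^ 2 * τ ^ 2 ≤ C := by
    have := mul_le_mul_of_nonneg_right hb hτ2.le
    rwa [mul_assoc, inv_mul_cancel₀ hτ2.ne', mul_one] at this
  -- from C/ε² + 1 ≤ τ and τ ≥ 1: C ≤ (τ - 1) ε² ≤ ... we get Y² ≤ ε²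
  have hε2 : 0 < ε ^ 2 := by positivity
  have hCle : C ≤ (τ - 1) * ε ^ 2 := by
    have := (div_le_iff₀ hε2).1 (by linarith : C / ε ^ 2 ≤ τ - 1)
    linarith
  have hY2 : Y ^ 2 ≤ ε ^ 2 := by
    by_contra hcon
    rw [not_le] at hcon
    -- `Y² > ε²` would give `Y²τ² > ε²τ² > (τ - 1)ε² ≥ C ≥ Y²τ²`.
    have h1 : ε ^ 2 * τ ^ 2 < Y ^ 2 * τ ^ 2 := mul_lt_mul_of_pos_right hcon hτ2
    have h2 : (τ - 1) * ε ^ 2 < ε ^ 2 * τ ^ 2 := by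
      nlinarith [mul_nonneg (mul_nonneg hε2.le hτpos.le) (sub_nonneg.2 hτ1), hε2]
    linarith
  exact abs_le_of_sq_le_sq hY2 hε.le

end Literature.Barriers.FinalStateConjecture

end
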